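import Summits.BirchSwinnertonDyer.BirchSwinnertonDyer.Theorems.ByReductionTypeAtTwoOrdKatoHalfAtTwoIsoZetaColemanMuIotaKatoCarriers
import Summits.BirchSwinnertonDyer.BirchSwinnertonDyer.Theorems.ByReductionTypeAtTwoOrdKatoHalfAtTwoIsoColemanMuSpanFreeKatoCarriers
import Summits.BirchSwinnertonDyer.BirchSwinnertonDyer.Theorems.ByReductionTypeAtTwoOrdKatoHalfAtTwoIsoColemanMuFreeValueOrdKernel
import Summits.BirchSwinnertonDyer.BirchSwinnertonDyer.Theorems.ByReductionTypeAtTwoOrdKatoHalfAtTwoIsoRelaxedRoadsLemma46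
import Summits.BirchSwinnertonDyer.BirchSwinnertonDyer.Theorems.ByReductionTypeAtTwoOrdKatoHalfAtTwoIsoPosDiscSplit
import Summits.BirchSwinnertonDyer.BirchSwinnertonDyer.Theorems.ByReductionTypeAtTwoOrdKatoHalfAtTwoIsoPosDiscEpsilon
import Literature.NumberTheory.EllipticCurves.FineSelmerLimThm35AtTwoUpstairsProofs
import Literature.NumberTheory.EllipticCurves.Kato2004.LocalIwasawaCohomologyTateDuality
import Literature.NumberTheory.EllipticCurves.Kato2004.LocalIwasawaCohomologyOrdinaryQuotient
import HarnessLib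

/-!
# Cert49 (crux-triage r1 seat 2/2, GEN 49) — the W2∓ RE-CUT suggested by the width seat w3 g5 (evidence 24097 #16
# `F1StubsMuFreeValue.lean` b8d58f870fbf7232, variants §A / §B), PRE-VETTED against the registered skeleton v22
# (`cd116ac15046672b…`, 8 stubs) of the line `steinberg-fibre-at-two` for the crux `OrdKatoHalfAtTwoIso`
# (stmt-BirchSwinnertonDyer-19573): by-name DERIVATION of the registered memo texts from the re-cut texts, their
# EQUIVALENCE in the kernel (no re-pricing), and JOINT SUFFICIENCY of both prospective stub tuples for the crux and for
# child 24097 BY NAME — all over TREE modules only (p720644, p723623, p723619, p727025, p727215, p727801 + the v22 glue doors).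

Registered v22 (unchanged at 2026-08-29T15:2xZ; no v23): t1 `stub_tateDualityTower` (Literature fact p723619), t2 = `T2` (W2⁻), t3 = `T3`
(W2⁺), t4 `FineSelmerConjATwoOrdPosDisc`, t5 bundle (= child 23889), t6 `RelaxedZetaOptimalAtTwoExistsMemberFlat`, t7 Ferrero–Washington,
t8 Greenberg L.4.6@2 — see Cert48 (crux commit 671d2aaf3572) for the v22 read itself.

The re-cut texts (§0, VERBATIM from w3's file): §A replaces t2/t3 by the ∃-texts `VA2`/`VA3` («∃ col with ker col ≤ range(J′ → J) and a
(GENUINE) class with col(loc₂ ·) ∉ (2)»; stub count 8); §B adds the cite stub `Kato2004.exists_ordinaryKernelFunctional` (Literature fact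
p727215, PRINT-COMPOSITE at every p, audit-2 D-sheet hOKF PASS) and replaces t2/t3 by the ∀-texts `VB2`/`VB3` («EVERY normalised
ordinary-kernel functional takes a value ∉ (2) at loc₂ of some (GENUINE) class»; stub count 9).

§1: T2 ⟸ VA2 ⟸ (hOKF ∧ VB2) and T3 ⟸ VA3 ⟸ (hOKF ∧ VB3) BY NAME (p727025 §2, p727801 §1), and conversely VA2 ⟸ T2, VA3 ⟸ T3
(p727025 §2: `(2)` prime + analytic μ₂ = 0 PROVED on ρ̄₂-onto) — so §A is EQUIVALENT to the registered pair in the kernel and §B DERIVES it: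
by the seat-2 acceptance rule (TRIAGE-r1-2 §B (a)) either re-cut, if registered as v23 with the other six texts byte-identical, READS PASS.
§2: the crux BY NAME from the §A 8-tuple and from the §B 9-tuple (the v22 chain of Cert48 §2 / the doors of p727025 §3 and p727801 §2).
§3: child 24097 BY NAME from both tuples; children 23921 / 23889 do not involve t2/t3 (Cert48 §3 unchanged).

HONEST STATUS: CONDITIONAL compositions and implications between displayed OPEN statements only. Nothing here proves a stub, the
crux, a child, or BSD. VA∓ / VB∓ / T2 / T3 are memo-tier readings of Kato §§12–17 at p = 2 NOT in print as stated; hOKF and t1 are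
PRINT-COMPOSITE Literature readings (+1 declared debt each, not theorems); t4 is an OPEN conjecture.
-/

set_option autoImplicit false
set_option linter.dupNamespace false

noncomputable section

open scoped Classical MatrixGroups ModularForm NumberField
open CongruenceSubgroup WeierstrassCurve Field IsDedekindDomain NumberField
open Literature.NumberTheory.GaloisRepresentations
open Literature.NumberTheory.GaloisCohomology
open Literature.NumberTheory.EllipticCurves Literature.NumberTheory.EllipticCurves.ModularForms
  Literature.NumberTheory.EllipticCurves.GreenbergSelmer
open Literature.NumberTheory.EllipticCurves.Kato2004
  Literature.NumberTheory.EllipticCurves.Kato2004.EulerSystemValues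
open Literature.NumberTheory.EllipticCurves.IwasawaDual
open Literature.NumberTheory.EllipticCurves.Rank1Residual
open Literature.NumberTheory.EllipticCurves.Greenberg1999
open Summit.BirchSwinnertonDyer.Rank1Residual Summit.BirchSwinnertonDyer.Rank1Residual.X5

open Summit.BirchSwinnertonDyer.BirchSwinnertonDyer.Theorems.OrdKatoOptimalAtTwo
open Summit.BirchSwinnertonDyer.BirchSwinnertonDyer.Theses.ByReductionTypeAtTwo
open Summit.BirchSwinnertonDyer.BirchSwinnertonDyer.Theorems.SteinbergFibreAtTwo
open Literature.NumberTheory.IwasawaTheory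

namespace Summit.BirchSwinnertonDyer.BirchSwinnertonDyer.Cruxes.OrdKatoHalfAtTwoIso.Cert49

/-! ### §0 The texts, VERBATIM -/

/-- `T2` := the TYPE of v22's registered `stub_colemanERL_negDisc_two` (W2⁻; = Cert48.T2 byte-for-byte). Memo tier, NOT in print as
stated at `p = 2`; hypothesis only. [cite: Kato2004Asterisque, Thm. 12.6 (p. 222), Thm. 16.6 (2) (p. 271), Prop. 17.11 (p. 277) (shape)] -/
def T2 : Prop := ∀ (W : WeierstrassCurve ℚ) [W.IsElliptic] [W.IsGloballyMinimal]
      [ContinuousSMul ℤ_[2] (W.tateModule 2)] [Module.Free ℤ_[2] (W.tateModule 2)] [Module.Finite ℤ_[2] (W.tateModule 2)]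
      {N : ℕ} [NeZero N] (f : CuspForm (Gamma0 N) 2)
      (κ : ZpExtension ℚ 2) (γ : absoluteGaloisGroup ℚ) (hκ : κ.IsCyclotomic) (hγ : κ.IsTopGenerator γ),
      W.Δ < 0 → IsOrdinaryAt W 2 → W.HasSurjectiveModNGaloisRep 2 → IsCyclotomicVariable 2 γ → IsNewformOf W f →
      ∀ (v₂ : HeightOneSpectrum (𝓞 ℚ)) (_ : ((2 : ℕ) : 𝓞 ℚ) ∈ v₂.asIdeal)
        (γᵥ : absoluteGaloisGroup (v₂.adicCompletion ℚ))
        (hsurj : Function.Surjective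
          (κ.toContinuousMonoidHom.comp (resGalOfEmb (closureEmb (K := ℚ) (v₂.adicCompletion ℚ)))))
        (hγᵥ : κ.IsTopGenerator (resGalOfEmb (closureEmb (K := ℚ) (v₂.adicCompletion ℚ)) γᵥ))
        (I : IwasawaH1Data W 2 κ γ) (J : LocalIwasawaH1Data κ v₂ ((tateRep W 2).toLocal v₂) γᵥ)
        (J' : LocalIwasawaH1Data κ v₂ (tateLocalOrdinaryRep W 2 v₂) γᵥ),
      ∃ col : J.H →ₗ[IwasawaAlgebra 2] IwasawaAlgebra 2,
        (∀ x : J.H, col x = 0 → x ∈ LinearMap.range (J'.ordinaryInclusion J)) ∧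
        ∃ g : I.H, IsEulerSystemClassTwo W hκ I g ∧
          ∃ (u : (IwasawaAlgebra 2)ˣ) (M L' : IwasawaAlgebra 2) (r : ℚ_[2]),
            M ∉ IwasawaAlgebra.augIdealP 2 ∧ ‖r‖ = 1 ∧
              iwasawaToPowerSeries 2 L' = PowerSeries.C r * padicLFunction f (unitRoot W 2 : ℚ_[2]) ∧
              col (I.loc J hsurj hγ hγᵥ g) = (u : IwasawaAlgebra 2) * M * L'

/-- `T3` := the TYPE of v22's registered `stub_colemanHalf_posDisc_two` (W2⁺; = Cert48.T3 byte-for-byte). Memo tier; hypothesis only.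
[cite: Kato2004Asterisque, Thm. 12.5 (1) (p. 221), Prop. 17.11 (p. 277) (shape)] -/
def T3 : Prop := ∀ (W : WeierstrassCurve ℚ) [W.IsElliptic] [W.IsGloballyMinimal]
      [ContinuousSMul ℤ_[2] (W.tateModule 2)] [Module.Free ℤ_[2] (W.tateModule 2)] [Module.Finite ℤ_[2] (W.tateModule 2)]
      {N : ℕ} [NeZero N] (f : CuspForm (Gamma0 N) 2)
      (κ : ZpExtension ℚ 2) (γ : absoluteGaloisGroup ℚ) (hκ : κ.IsCyclotomic) (hγ : κ.IsTopGenerator γ),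
      0 < W.Δ → IsOrdinaryAt W 2 → W.HasSurjectiveModNGaloisRep 2 → IsCyclotomicVariable 2 γ → IsNewformOf W f →
      ∀ (v₂ : HeightOneSpectrum (𝓞 ℚ)) (_ : ((2 : ℕ) : 𝓞 ℚ) ∈ v₂.asIdeal)
        (γᵥ : absoluteGaloisGroup (v₂.adicCompletion ℚ))
        (hsurj : Function.Surjective
          (κ.toContinuousMonoidHom.comp (resGalOfEmb (closureEmb (K := ℚ) (v₂.adicCompletion ℚ)))))
        (hγᵥ : κ.IsTopGenerator (resGalOfEmb (closureEmb (K := ℚ) (v₂.adicCompletion ℚ)) γᵥ))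
        (I : IwasawaH1Data W 2 κ γ) (J : LocalIwasawaH1Data κ v₂ ((tateRep W 2).toLocal v₂) γᵥ)
        (J' : LocalIwasawaH1Data κ v₂ (tateLocalOrdinaryRep W 2 v₂) γᵥ),
      ∃ col : J.H →ₗ[IwasawaAlgebra 2] IwasawaAlgebra 2,
        (∀ x : J.H, col x = 0 → x ∈ LinearMap.range (J'.ordinaryInclusion J)) ∧
        ∃ (y : I.H) (u : (IwasawaAlgebra 2)ˣ) (M L' : IwasawaAlgebra 2) (r : ℚ_[2]),
            M ∉ IwasawaAlgebra.augIdealP 2 ∧ ‖r‖ = 1 ∧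
              iwasawaToPowerSeries 2 L' = PowerSeries.C r * padicLFunction f (unitRoot W 2 : ℚ_[2]) ∧
              col (I.loc J hsurj hγ hγᵥ y) = (u : IwasawaAlgebra 2) * M * L'

/-- `VA2` := §A ∃-text V⁻ (w3's `stub_muFree_negDisc_two`, verbatim): an ordinary-kernel functional with a μ-free value on a GENUINE class,
cell `Δ < 0`. Memo tier; hypothesis only. [cite: Kato2004Asterisque, Thm. 12.6 (p. 222), Thm. 16.6 (2) (p. 271) (shape)] -/
def VA2 : Prop := ∀ (W : WeierstrassCurve ℚ) [W.IsElliptic] [W.IsGloballyMinimal]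
      [ContinuousSMul ℤ_[2] (W.tateModule 2)] [Module.Free ℤ_[2] (W.tateModule 2)] [Module.Finite ℤ_[2] (W.tateModule 2)]
      {N : ℕ} [NeZero N] (f : CuspForm (Gamma0 N) 2)
      (κ : ZpExtension ℚ 2) (γ : absoluteGaloisGroup ℚ) (hκ : κ.IsCyclotomic) (hγ : κ.IsTopGenerator γ),
      W.Δ < 0 → IsOrdinaryAt W 2 → W.HasSurjectiveModNGaloisRep 2 → IsCyclotomicVariable 2 γ → IsNewformOf W f →
      ∀ (v₂ : HeightOneSpectrum (𝓞 ℚ)) (_ : ((2 : ℕ) : 𝓞 ℚ) ∈ v₂.asIdeal)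
        (γᵥ : absoluteGaloisGroup (v₂.adicCompletion ℚ))
        (hsurj : Function.Surjective
          (κ.toContinuousMonoidHom.comp (resGalOfEmb (closureEmb (K := ℚ) (v₂.adicCompletion ℚ)))))
        (hγᵥ : κ.IsTopGenerator (resGalOfEmb (closureEmb (K := ℚ) (v₂.adicCompletion ℚ)) γᵥ))
        (I : IwasawaH1Data W 2 κ γ) (J : LocalIwasawaH1Data κ v₂ ((tateRep W 2).toLocal v₂) γᵥ)
        (J' : LocalIwasawaH1Data κ v₂ (tateLocalOrdinaryRep W 2 v₂) γᵥ),
      ∃ col : J.H →ₗ[IwasawaAlgebra 2] IwasawaAlgebra 2,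
        (∀ x : J.H, col x = 0 → x ∈ LinearMap.range (J'.ordinaryInclusion J)) ∧
        ∃ g : I.H, IsEulerSystemClassTwo W hκ I g ∧ col (I.loc J hsurj hγ hγᵥ g) ∉ IwasawaAlgebra.augIdealP 2

/-- `VA3` := §A ∃-text V⁺ (w3's `stub_muFree_posDisc_two`, verbatim): the same with ONE global class, cell `0 < Δ`. Memo tier; hypothesis only.
[cite: Kato2004Asterisque, Thm. 12.5 (1) (p. 221) (shape)] [cite: GreenbergLNM1716, Conj. 1.11 (p. 64) (shape)] -/
def VA3 : Prop := ∀ (W : WeierstrassCurve ℚ) [W.IsElliptic] [W.IsGloballyMinimal]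
      [ContinuousSMul ℤ_[2] (W.tateModule 2)] [Module.Free ℤ_[2] (W.tateModule 2)] [Module.Finite ℤ_[2] (W.tateModule 2)]
      {N : ℕ} [NeZero N] (f : CuspForm (Gamma0 N) 2)
      (κ : ZpExtension ℚ 2) (γ : absoluteGaloisGroup ℚ) (hκ : κ.IsCyclotomic) (hγ : κ.IsTopGenerator γ),
      0 < W.Δ → IsOrdinaryAt W 2 → W.HasSurjectiveModNGaloisRep 2 → IsCyclotomicVariable 2 γ → IsNewformOf W f →
      ∀ (v₂ : HeightOneSpectrum (𝓞 ℚ)) (_ : ((2 : ℕ) : 𝓞 ℚ) ∈ v₂.asIdeal)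
        (γᵥ : absoluteGaloisGroup (v₂.adicCompletion ℚ))
        (hsurj : Function.Surjective
          (κ.toContinuousMonoidHom.comp (resGalOfEmb (closureEmb (K := ℚ) (v₂.adicCompletion ℚ)))))
        (hγᵥ : κ.IsTopGenerator (resGalOfEmb (closureEmb (K := ℚ) (v₂.adicCompletion ℚ)) γᵥ))
        (I : IwasawaH1Data W 2 κ γ) (J : LocalIwasawaH1Data κ v₂ ((tateRep W 2).toLocal v₂) γᵥ)
        (J' : LocalIwasawaH1Data κ v₂ (tateLocalOrdinaryRep W 2 v₂) γᵥ),
      ∃ col : J.H →ₗ[IwasawaAlgebra 2] IwasawaAlgebra 2,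
        (∀ x : J.H, col x = 0 → x ∈ LinearMap.range (J'.ordinaryInclusion J)) ∧
        ∃ y : I.H, col (I.loc J hsurj hγ hγᵥ y) ∉ IwasawaAlgebra.augIdealP 2

/-- `VB2` := §B ∀-text V♭⁻ (w3's `stub_muFreeValue_negDisc_two`, verbatim): EVERY normalised ordinary-kernel functional (`ker col = range`
exactly, some value `∉ (2)`) is `2`-primitive at `loc₂ g` of some GENUINE class `g`, cell `Δ < 0`. Memo tier; hypothesis only.
[cite: Kato2004Asterisque, Thm. 12.6 (p. 222), Thm. 16.6 (2) (p. 271) (shape)] -/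
def VB2 : Prop := ∀ (W : WeierstrassCurve ℚ) [W.IsElliptic] [W.IsGloballyMinimal]
      [ContinuousSMul ℤ_[2] (W.tateModule 2)] [Module.Free ℤ_[2] (W.tateModule 2)] [Module.Finite ℤ_[2] (W.tateModule 2)]
      {N : ℕ} [NeZero N] (f : CuspForm (Gamma0 N) 2)
      (κ : ZpExtension ℚ 2) (γ : absoluteGaloisGroup ℚ) (hκ : κ.IsCyclotomic) (hγ : κ.IsTopGenerator γ),
      W.Δ < 0 → IsOrdinaryAt W 2 → W.HasSurjectiveModNGaloisRep 2 → IsCyclotomicVariable 2 γ → IsNewformOf W f →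
      ∀ (v₂ : HeightOneSpectrum (𝓞 ℚ)) (_ : ((2 : ℕ) : 𝓞 ℚ) ∈ v₂.asIdeal)
        (γᵥ : absoluteGaloisGroup (v₂.adicCompletion ℚ))
        (hsurj : Function.Surjective
          (κ.toContinuousMonoidHom.comp (resGalOfEmb (closureEmb (K := ℚ) (v₂.adicCompletion ℚ)))))
        (hγᵥ : κ.IsTopGenerator (resGalOfEmb (closureEmb (K := ℚ) (v₂.adicCompletion ℚ)) γᵥ))
        (I : IwasawaH1Data W 2 κ γ) (J : LocalIwasawaH1Data κ v₂ ((tateRep W 2).toLocal v₂) γᵥ)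
        (J' : LocalIwasawaH1Data κ v₂ (tateLocalOrdinaryRep W 2 v₂) γᵥ)
        (col : J.H →ₗ[IwasawaAlgebra 2] IwasawaAlgebra 2),
        (∀ x : J.H, col x = 0 ↔ x ∈ LinearMap.range (J'.ordinaryInclusion J)) →
        (∃ x : J.H, col x ∉ IwasawaAlgebra.augIdealP 2) →
        ∃ g : I.H, IsEulerSystemClassTwo W hκ I g ∧ col (I.loc J hsurj hγ hγᵥ g) ∉ IwasawaAlgebra.augIdealP 2

/-- `VB3` := §B ∀-text V♭⁺ (w3's `stub_muFreeValue_posDisc_two`, verbatim): the same with ONE global class `y ∈ 𝐇¹_Γ`, cell `0 < Δ`.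
Memo tier; hypothesis only. [cite: Kato2004Asterisque, Thm. 12.5 (1) (p. 221) (shape)] [cite: GreenbergLNM1716, Conj. 1.11 (p. 64) (shape)] -/
def VB3 : Prop := ∀ (W : WeierstrassCurve ℚ) [W.IsElliptic] [W.IsGloballyMinimal]
      [ContinuousSMul ℤ_[2] (W.tateModule 2)] [Module.Free ℤ_[2] (W.tateModule 2)] [Module.Finite ℤ_[2] (W.tateModule 2)]
      {N : ℕ} [NeZero N] (f : CuspForm (Gamma0 N) 2)
      (κ : ZpExtension ℚ 2) (γ : absoluteGaloisGroup ℚ) (hκ : κ.IsCyclotomic) (hγ : κ.IsTopGenerator γ),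
      0 < W.Δ → IsOrdinaryAt W 2 → W.HasSurjectiveModNGaloisRep 2 → IsCyclotomicVariable 2 γ → IsNewformOf W f →
      ∀ (v₂ : HeightOneSpectrum (𝓞 ℚ)) (_ : ((2 : ℕ) : 𝓞 ℚ) ∈ v₂.asIdeal)
        (γᵥ : absoluteGaloisGroup (v₂.adicCompletion ℚ))
        (hsurj : Function.Surjective
          (κ.toContinuousMonoidHom.comp (resGalOfEmb (closureEmb (K := ℚ) (v₂.adicCompletion ℚ)))))
        (hγᵥ : κ.IsTopGenerator (resGalOfEmb (closureEmb (K := ℚ) (v₂.adicCompletion ℚ)) γᵥ))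
        (I : IwasawaH1Data W 2 κ γ) (J : LocalIwasawaH1Data κ v₂ ((tateRep W 2).toLocal v₂) γᵥ)
        (J' : LocalIwasawaH1Data κ v₂ (tateLocalOrdinaryRep W 2 v₂) γᵥ)
        (col : J.H →ₗ[IwasawaAlgebra 2] IwasawaAlgebra 2),
        (∀ x : J.H, col x = 0 ↔ x ∈ LinearMap.range (J'.ordinaryInclusion J)) →
        (∃ x : J.H, col x ∉ IwasawaAlgebra.augIdealP 2) →
        ∃ y : I.H, col (I.loc J hsurj hγ hγᵥ y) ∉ IwasawaAlgebra.augIdealP 2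

/-! ### §1 Derivations and equivalences BY NAME (tree doors p727025 §2, p727801 §1) -/

/-- Registered W2⁻ from the §A text (rescaling by `ι⁻¹L₂(f,α)`: INT2-AUTO + Rohrlich; p727025). CONDITIONAL. -/
theorem t2_of_VA2 (h : VA2) : T2 := colemanERL_negDisc_two_of_muFreeValue h

/-- §A text from the registered W2⁻ (`(2)` prime + analytic `μ₂ = 0` PROVED on ρ̄₂-onto; p727025). CONDITIONAL. -/
theorem VA2_of_t2 (h : T2) : VA2 := muFreeValue_of_colemanERL_negDisc_two h

/-- Registered W2⁺ from the §A text (p727025). CONDITIONAL. -/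
theorem t3_of_VA3 (h : VA3) : T3 := colemanHalf_posDisc_two_of_muFreeValue h

/-- §A text from the registered W2⁺ (p727025). CONDITIONAL. -/
theorem VA3_of_t3 (h : T3) : VA3 := muFreeValue_of_colemanHalf_posDisc_two h

/-- **§A is EQUIVALENT to the registered pair in the kernel** — no re-pricing. -/
theorem recutA_iff_v22 : (VA2 ∧ VA3) ↔ (T2 ∧ T3) :=
  ⟨fun h => ⟨t2_of_VA2 h.1, t3_of_VA3 h.2⟩, fun h => ⟨VA2_of_t2 h.1, VA3_of_t3 h.2⟩⟩

/-- §A text from the Literature fact p727215 (BY NAME, read at `2` inside the door) + the §B ∀-text (p727801 §1). CONDITIONAL. -/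
theorem VA2_of_hOKF_VB2 (hOK : Literature.NumberTheory.EllipticCurves.Kato2004.exists_ordinaryKernelFunctional) (h : VB2) : VA2 :=
  muFreeValue_negDisc_of_ordKernel hOK h

/-- Idem on `0 < Δ`. CONDITIONAL. -/
theorem VA3_of_hOKF_VB3 (hOK : Literature.NumberTheory.EllipticCurves.Kato2004.exists_ordinaryKernelFunctional) (h : VB3) : VA3 :=
  muFreeValue_posDisc_of_ordKernel hOK h

/-- **§B DERIVES the registered pair** (fact + ∀-texts ⟹ W2⁻ ∧ W2⁺). CONDITIONAL. -/
theorem v22_of_recutB (hOK : Literature.NumberTheory.EllipticCurves.Kato2004.exists_ordinaryKernelFunctional) (h2 : VB2) (h3 : VB3) :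
    T2 ∧ T3 :=
  ⟨t2_of_VA2 (VA2_of_hOKF_VB2 hOK h2), t3_of_VA3 (VA3_of_hOKF_VB3 hOK h3)⟩

/-- The kernel clause of the fact, read at `2`, has the registered stubs' «≤»-shape as a special case (the fact's `↔` is STRONGER: `=`).
Nothing asserted. -/
theorem kernelClause_le_of_fact (hOK : Literature.NumberTheory.EllipticCurves.Kato2004.exists_ordinaryKernelFunctional)
    (W : WeierstrassCurve ℚ) [W.IsElliptic] [W.IsGloballyMinimal] [ContinuousSMul ℤ_[2] (W.tateModule 2)]
    (κ : ZpExtension ℚ 2) (v : HeightOneSpectrum (𝓞 ℚ)) (γᵥ : absoluteGaloisGroup (v.adicCompletion ℚ))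
    (hκ : κ.IsCyclotomic) (hv : ((2 : ℕ) : 𝓞 ℚ) ∈ v.asIdeal) (hord : IsOrdinaryAt W 2)
    (hγᵥ : κ.IsTopGenerator (resGalOfEmb (closureEmb (K := ℚ) (v.adicCompletion ℚ)) γᵥ))
    (J : LocalIwasawaH1Data κ v ((tateRep W 2).toLocal v) γᵥ) (J' : LocalIwasawaH1Data κ v (tateLocalOrdinaryRep W 2 v) γᵥ) :
    ∃ col : J.H →ₗ[IwasawaAlgebra 2] IwasawaAlgebra 2,
      (∀ x : J.H, col x = 0 → x ∈ LinearMap.range (J'.ordinaryInclusion J)) ∧ ∃ x : J.H, col x ∉ IwasawaAlgebra.augIdealP 2 := by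
  obtain ⟨col, hker, hval⟩ := hOK 2 W κ v γᵥ hκ hv hord hγᵥ J J'
  exact ⟨col, fun x hx => (hker x).mp hx, hval⟩

/-! ### §2 The crux BY NAME from either prospective tuple (tree doors only) -/

/-- Kato 17.4 (1)(2) at `2` is the third conjunct of the PUB item (extraction, as in the skeleton). -/
theorem kato1712_at_two_of_pub (hPub : Summit.BirchSwinnertonDyer.BirchSwinnertonDyer.Theses.ByReductionTypeAtTwo.OrdPublishedInputsAtTwo) :
    ∀ (V : WeierstrassCurve ℚ) [V.IsElliptic] [V.IsGloballyMinimal] [NeZero (V.conductorNorm ℤ)]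
      (f : CuspForm (Gamma0 (V.conductorNorm ℤ)) 2), kato_divisibility_allPrimes V 2 (f := f) := by
  obtain ⟨_, _, h17, _⟩ := hPub
  exact h17

/-- The v22 chain (Cert48 §2, re-inlined): crux ⟸ (t1, T2, T3, t4, …, t8) BY NAME; `t5.2.2` (Greenberg 5.14@2) idle. CONDITIONAL. -/
theorem ordKatoHalfAtTwoIso_of_v22
    (t1 : exists_lambdaAdicLocalTatePairing_selmer_orthogonal) (t2 : T2) (t3 : T3)
    (t4 : FineSelmerConjATwoOrdPosDisc)
    (t5 : Literature.Uncategorized.OrdPublishedInputsAtTwo ∧ abbesUllmo_not_dvd_maninConstant_of_not_dvd_level ∧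
      Literature.NumberTheory.EllipticCurves.Greenberg1999.prop514_isTorsion_mu_eq_zero_two)
    (t6 : RelaxedZetaOptimalAtTwoExistsMemberFlat)
    (t7 : Literature.NumberTheory.IwasawaTheory.ferreroWashington1979_classicalMuVanishes)
    (t8 : Greenberg1999.lemma46_relaxed_mod_selmer_infinite_rat_two) :
    Summit.BirchSwinnertonDyer.BirchSwinnertonDyer.Theses.ByReductionTypeAtTwo.OrdKatoHalfAtTwoIso :=
  have h17 := kato1712_at_two_of_pub t5.1
  ordKatoHalfAtTwoIso_of_iota_halves_B7 (zetaColemanMuIotaNegDiscAtTwo_of_katoCarriers (t1 2) t2)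
    (ordKatoHalfAtTwoIsoPosDisc_of_epsilon (colemanMuSpanFreeIotaPosDiscAtTwo_of_katoCarriers (t1 2) t3) t4 t5.2.1 h17) t5.2.1
    (katoMuPartAtOptimalMember_of_existsMemberFlat_of_lemma46
      Lim2017.thm35_at_two_upstairs_fineSelmer_twoTorsion_finite_of_classicalMuVanishes_holds t7 t6 t8 h17) h17

/-- **Crux BY NAME from the §A 8-tuple** (t1, VA2, VA3, t4, …, t8). CONDITIONAL; nothing closed; BSD not proved. -/
theorem ordKatoHalfAtTwoIso_of_recutA
    (t1 : exists_lambdaAdicLocalTatePairing_selmer_orthogonal) (a2 : VA2) (a3 : VA3)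
    (t4 : FineSelmerConjATwoOrdPosDisc)
    (t5 : Literature.Uncategorized.OrdPublishedInputsAtTwo ∧ abbesUllmo_not_dvd_maninConstant_of_not_dvd_level ∧
      Literature.NumberTheory.EllipticCurves.Greenberg1999.prop514_isTorsion_mu_eq_zero_two)
    (t6 : RelaxedZetaOptimalAtTwoExistsMemberFlat)
    (t7 : Literature.NumberTheory.IwasawaTheory.ferreroWashington1979_classicalMuVanishes)
    (t8 : Greenberg1999.lemma46_relaxed_mod_selmer_infinite_rat_two) :
    Summit.BirchSwinnertonDyer.BirchSwinnertonDyer.Theses.ByReductionTypeAtTwo.OrdKatoHalfAtTwoIso :=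
  ordKatoHalfAtTwoIso_of_v22 t1 (t2_of_VA2 a2) (t3_of_VA3 a3) t4 t5 t6 t7 t8

/-- **Crux BY NAME from the §B 9-tuple** (t1, hOKF, VB2, VB3, t4, …, t8). CONDITIONAL; nothing closed; BSD not proved. -/
theorem ordKatoHalfAtTwoIso_of_recutB
    (t1 : exists_lambdaAdicLocalTatePairing_selmer_orthogonal)
    (hOK : Literature.NumberTheory.EllipticCurves.Kato2004.exists_ordinaryKernelFunctional) (b2 : VB2) (b3 : VB3)
    (t4 : FineSelmerConjATwoOrdPosDisc)
    (t5 : Literature.Uncategorized.OrdPublishedInputsAtTwo ∧ abbesUllmo_not_dvd_maninConstant_of_not_dvd_level ∧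
      Literature.NumberTheory.EllipticCurves.Greenberg1999.prop514_isTorsion_mu_eq_zero_two)
    (t6 : RelaxedZetaOptimalAtTwoExistsMemberFlat)
    (t7 : Literature.NumberTheory.IwasawaTheory.ferreroWashington1979_classicalMuVanishes)
    (t8 : Greenberg1999.lemma46_relaxed_mod_selmer_infinite_rat_two) :
    Summit.BirchSwinnertonDyer.BirchSwinnertonDyer.Theses.ByReductionTypeAtTwo.OrdKatoHalfAtTwoIso :=
  have h := v22_of_recutB hOK b2 b3
  ordKatoHalfAtTwoIso_of_v22 t1 h.1 h.2 t4 t5 t6 t7 t8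

/-- The same §B composition through w3's OWN doors (p727801 §2: F1μι⁻ / P⁺ from the two facts + V♭∓), as a cross-check that the two
door systems agree on the crux. CONDITIONAL. -/
theorem ordKatoHalfAtTwoIso_of_recutB'
    (t1 : exists_lambdaAdicLocalTatePairing_selmer_orthogonal)
    (hOK : Literature.NumberTheory.EllipticCurves.Kato2004.exists_ordinaryKernelFunctional) (b2 : VB2) (b3 : VB3)
    (t4 : FineSelmerConjATwoOrdPosDisc)
    (t5 : Literature.Uncategorized.OrdPublishedInputsAtTwo ∧ abbesUllmo_not_dvd_maninConstant_of_not_dvd_level ∧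
      Literature.NumberTheory.EllipticCurves.Greenberg1999.prop514_isTorsion_mu_eq_zero_two)
    (t6 : RelaxedZetaOptimalAtTwoExistsMemberFlat)
    (t7 : Literature.NumberTheory.IwasawaTheory.ferreroWashington1979_classicalMuVanishes)
    (t8 : Greenberg1999.lemma46_relaxed_mod_selmer_infinite_rat_two) :
    Summit.BirchSwinnertonDyer.BirchSwinnertonDyer.Theses.ByReductionTypeAtTwo.OrdKatoHalfAtTwoIso :=
  have h17 := kato1712_at_two_of_pub t5.1
  ordKatoHalfAtTwoIso_of_iota_halves_B7
    (zetaColemanMuIotaNegDiscAtTwo_of_tateDuality_of_ordKernel_of_muFreeValue t1 hOK b2)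
    (ordKatoHalfAtTwoIsoPosDisc_of_epsilon
      (colemanMuSpanFreeIotaPosDiscAtTwo_of_tateDuality_of_ordKernel_of_muFreeValue t1 hOK b3) t4 t5.2.1 h17) t5.2.1
    (katoMuPartAtOptimalMember_of_existsMemberFlat_of_lemma46
      Lim2017.thm35_at_two_upstairs_fineSelmer_twoTorsion_finite_of_classicalMuVanishes_holds t7 t6 t8 h17) h17

/-! ### §3 Child 24097 BY NAME from either tuple (23921 / 23889 do not involve t2 / t3: Cert48 §3 stands) -/

/-- **Child 24097 `OrdKatoFineZetaAtTwoResidue` BY NAME from the §A texts** (+ t1, t4, t5.1, t5.2.1). CONDITIONAL. -/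
theorem child24097_of_recutA
    (t1 : exists_lambdaAdicLocalTatePairing_selmer_orthogonal) (a2 : VA2) (a3 : VA3)
    (t4 : FineSelmerConjATwoOrdPosDisc)
    (t5 : Literature.Uncategorized.OrdPublishedInputsAtTwo ∧ abbesUllmo_not_dvd_maninConstant_of_not_dvd_level ∧
      Literature.NumberTheory.EllipticCurves.Greenberg1999.prop514_isTorsion_mu_eq_zero_two) :
    Summit.BirchSwinnertonDyer.BirchSwinnertonDyer.Theses.ByReductionTypeAtTwo.OrdKatoFineZetaAtTwoResidue :=
  ordKatoFineZetaAtTwoResidue_of_negDisc_of_epsilon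
    (zetaColemanMuIotaNegDiscAtTwo_of_tateDuality_of_muFreeValue t1 a2)
    (colemanMuSpanFreeIotaPosDiscAtTwo_of_tateDuality_of_muFreeValue t1 a3) t4 t5.2.1 (kato1712_at_two_of_pub t5.1)

/-- **Child 24097 BY NAME from the §B texts** (+ t1, hOKF, t4, t5.1, t5.2.1) — w3's p727801 door, re-run. CONDITIONAL. -/
theorem child24097_of_recutB
    (t1 : exists_lambdaAdicLocalTatePairing_selmer_orthogonal)
    (hOK : Literature.NumberTheory.EllipticCurves.Kato2004.exists_ordinaryKernelFunctional) (b2 : VB2) (b3 : VB3)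
    (t4 : FineSelmerConjATwoOrdPosDisc)
    (t5 : Literature.Uncategorized.OrdPublishedInputsAtTwo ∧ abbesUllmo_not_dvd_maninConstant_of_not_dvd_level ∧
      Literature.NumberTheory.EllipticCurves.Greenberg1999.prop514_isTorsion_mu_eq_zero_two) :
    Summit.BirchSwinnertonDyer.BirchSwinnertonDyer.Theses.ByReductionTypeAtTwo.OrdKatoFineZetaAtTwoResidue :=
  ordKatoFineZetaAtTwoResidue_of_tateDuality_of_ordKernel_of_muFreeValues_of_conjA_of_print t1 hOK b2 b3 t4 t5.2.1
    (kato1712_at_two_of_pub t5.1)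

end Summit.BirchSwinnertonDyer.BirchSwinnertonDyer.Cruxes.OrdKatoHalfAtTwoIso.Cert49

end
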